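import Mathlib
import HarnessLib
import HarnessLib.Audit
import Summits.PneNP.Statement
import Literature.Computability.Complexity.Classes
import Literature.Computability.Complexity.Nondeterministic
import Literature.Computability.Complexity.CookBridges
import Literature.Computability.MetaComplexity.UniversalMachineProofs

/-!
Route: RootDecompExplicitRandom

DORMANT since 2026-09-04T14:27:44Z (reconciler: no traction for 5 d (last activity statement-checked at 2026-08-30T13:31:59Z); parked, not closed — `ledger route dormant route-PneNP-RootDecompExplicitRandom --off` to reactivate) — unstaffed, not closed; items shared with open routes are served there. `ledger route dormant <id> --off` reactivates.

Root-decomposition cell decomp-pnenp (D-0178), node N28 = proposal P28 (lens-3 gen 7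
«ExplicitRandomDial v2», HOME/decomp-pnenp-lens-3/ExplicitRandomDial.lean sha256 36e603a8; critic
CLEARED 2026-08-30T07:50:21Z). It suffices to show the two pieces of the law-D cut of P ≠ NP along
the EXPLICITNESS OF TIME-BOUNDED-RANDOM STRINGS on the standard clocked machine: ExplicitHard «if P
= NP then ONE fixed program of the tree interpreter ClockedUS.run, fed the numeral of n and run n^4
rounds, prints an n-bit string of K^{n^3} ≥ n for all large n» and ExplicitLift «such a
fixed-exponent printer of R_{K^{n^3}} already gives P ≠ NP» (declared residual). S ⟺ ExplicitHard ∧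
ExplicitLift hypothesis-free (pack pneNP_iff); the cell (a,b) = (3,4) at threshold id is the first
one outside the kernel-decided costume region b ≤ a (aside BottomRefuted33, proved) and below the
closure ∃b (= Korten–Santhanam Question 1, whose lift is ≡ S by theorem: aside KSQ1LiftId).
Lean: ExplicitHard → ExplicitLift → PneNP

Rationale: WHY THIS LINE. Every other node of the cell cuts P ≠ NP along a CLASS containment (space,
alternation, circuit depth, advice, MCSP-reduction strength, Kt-perebor exponent); this one cuts
along the CONSTRUCTIBILITY of hard objects — uniform range avoidance / Korten–Santhanam CCC 2025
Question 1 / Ren–Santhanam–Wang 2022 Hypothesis II.13 — typed on ONE definite machine (the tree's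
clocked flat-program interpreter ClockedUS.run with LINEAR simulation overhead, lens `std_sim`; K ≤
|x| + O(1) at constant budget, lens `ktAt_std_le`, so threshold id is maximal up to O(1)) so that
its two parameters are honest TM2 time exponents and no quantifier over machines is left for a junk
member to decide (erratum g6: the ∀U-typing over the bare UniversalMachine interface is throttlable
— critic probe 4b0c7f8a, lens `hardAllU_iff_pneNP`). The cut predicate Y has NO expected side: ¬S
gives a printer only at an unknown exponent, S says nothing about printers; so BOTH pieces carry
content and the (a,b)-knife distributes it (critic: S-inert status = law-D cut with genuinely
distributed content). Imported from meta-complexity: time-bounded Kolmogorov complexity K^t on a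
universal machine (tree UniversalMachine.ktAt, Liu–Pass 2020 §2.2), counting (Li–Vitányi Thm 2.2.1,
tree ncard_setOf_ktAt_lt), the PH-collapse prefix search (tree szkEntropy_phCollapse_standalone).
RANKED CRUXES. r2 ExplicitHard (attacked; IDEA-NEEDED, located at KS25 Q1 with T = n^3, ℓ = n, time
n^4; roads R1 KS25 printers from TIME-vs-TIME^NP/advice hypotheses, R2 explicit TM2 construction via
`explicitStd_of_outputsWithin`, R3 RSW22 range-avoidance equivalences). r3 ExplicitLift (declared
residual; needs non-relativising input, test T_fastAlg). Asides (banked): ExplicitHardSqrt /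
ExplicitLiftSqrt (g6 threshold √n; LiftSqrt ⟹ Lift in kernel = residual move of record), KSQ1HardId
(closure, TRUE mod two print binders) / KSQ1LiftId (closure lift ≡ S: costume by theorem),
BottomRefuted33 (cell (3,3) refuted: PROVED in the pack).
KILL CRITERIA. (k1) A theorem `ExplicitStd id 3 4 → PneNP` by padding/relativising means alone would
make ExplicitHard ≡ S (absorption law i) — the route then re-targets to a higher cell (a, b), b > 4,
or retires located-costume; (k2) a proof that ¬S ⟹ ExplicitStd id 3 4 outright (exponent-explicit
prefix search at b = 4 for every collapse exponent) makes ExplicitLift ≡ S (absorption law ii) —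
same re-target along b; (k3) an unconditional refutation of ExplicitStd id 3 4 (it would sit next to
E ⊄ P/poly-type statements: KS25 p.2–3 «any (K_T, n^{Ω(1)})-hard string for T > n^2 … truth table of
a hard function in E») makes the shadow ≡ S (absorption law iii). Each is a theorem-shaped event a
refuter can aim at; none is in print (KS25 p.2 L11–12).
NOT DECOMPOSED YET. The print binders CanonBitsInPHStd / PrinterFromDeciderStd (edges of the KSQ1
asides only, never in closes); the oracle-brick relativisation of ClockedUS needed to run tests
T_slowAlg / T_fastAlg; the exponent/threshold audit T_KS of KS25 §4 (does road R1 reach a fixed cell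
or only the closure?); higher cells (a, a+1) of the superdiagonal (pairwise incomparable minimal
lifts, lens monotonicity laws) are not filed.
CHEAPEST FALSIFIER. In Lean: `#h21_crux_probe` on both pieces vs PneNP (run: CLEAN, C → S fails for
both; pack). In print: an exponent-explicit version of KS25 Thm 24 at threshold n − O(1) with
construction time n^4 for T = n^3 (would close ExplicitHard S-agnostically and leave the residual
alone) — searched, absent (KS25 state i.o. results at threshold n − o(n) with unspecified exponent).

Novelty: Searches RUN (lens g6/g7 + critic + writer): `lean search 'ktAt'`, `lean search 'ClockedUS.run'`,
`lean search 'ExplicitStd|range avoidance|Avoid'` (tree: UniversalMachine / ClockedUS /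
UPSearchScheme modules only; no Theses route over a printer of random strings; negatives index
`ledger negatives --problem PneNP`: no statement about K^t-printers); corpus `lit search --hybrid
"explicit construction Kolmogorov random strings polynomial time"`, `lit vsearch "a polynomial time
algorithm printing strings of high time-bounded Kolmogorov complexity"`, galaxy `lit galaxy search
"range avoidance|K^t-random|Kolmogorov-random" --star all` → nearest prior art FOUND:
[corpus:paper:doi-10-4230-lipics-ccc-2025-35 p.2, p.5–6] Korten–Santhanam CCC 2025 (Question 1; Thms
2–3, 23–25: i.o. uniform printers at threshold n − o(n) from TIME vs TIME^NP-with-advice hypotheses;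
§5 black-box barriers to improving), [galaxy:pdf:2728609284854220960 p.12–13] Ren–Santhanam–Wang
FOCS 2022 (FP range avoidance for sparse maps ⟺ FP-printers of R_{K^t} ⟺ near-maximal-advice time
hierarchy; Hyp. II.13 «plausibility … remains to be investigated»), Ilango–Li–Williams 2023 /
Chen–Li 2024 (range avoidance algorithms with NP oracles: closure end, not fixed cells), Liu–Pass
2020 (K^t vs OWF: the EQUIV layer ABOVE S, lens `liuPassShadow_iff_pneNP`). Versus the cell's own
routes: N11 RootDecompMcspDial dials REDUCTION strength to MCSP, N16 RootDecompKtPerebor the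
NON-UNIFORM perebor exponent of MKtP; this node dials UN  [refs: paper:doi-10-4230-lipics-ccc-2025-35]

Barriers (technique_class: explicit-construction dial, Kt-random strings, law-D-carving): - technique_class: explicit-construction (range-avoidance) dial of K^t-random strings on the
standard clocked machine; law-D carving; roads = PH-collapse prefix search (R2), PRGs vs TIME^NP
with advice (R1, KS25), range-avoidance algorithms (R3)
- Literature.Barriers.PneNP.Relativization (BGS75): ExplicitHard — INSIDE for roads R2 (prefix
search under PH-collapse relativises) and R1 except where KS25's hypotheses are themselves
non-relativising; the bet is the instrument T_slowAlg (an oracle brick for ClockedUS with P^O =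
NP^O, collapse exponent ≥ 5, no fast K-queries) which would show the shadow needs non-relativising
input too — not claimed. ExplicitLift — it does not evade: a near-linear-time P^O = NP^O world
(TQBF-type) makes the relativised lift false (T_fastAlg), so the residual REQUIRES non-relativising
input; declared residual, priced as such (tribunal_fit.residual).
- Literature.Barriers.PneNP.NaturalProofs (RR97): OUTSIDE for both pieces — the cut predicate speaks
of ONE P-printable string per length (a sparse, non-large, non-constructive-in-the-RR-sense property
of a single sequence); RR quantifies over dense constructive properties of all functions. The E ⊄
P/poly-type consequence of an UNCONDITIONAL proof of Y (KS25 p.2–3) prices only the road «prove Y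
outright», which neither piece takes (A is conditional on ¬S, where EXP ⊄ P/poly is free: tree
precedent N16 `not_EXP_subset_PPoly_of_not_pneNP`).
- Literature.Barriers.PneNP.Algebrization (AW08): n/a — no arithmet

History (route lifecycle, newest last):
- 2026-09-04T14:27:44Z · DORMANT — reconciler: no traction for 5 d (last activity statement-checked at 2026-08-30T13:31:59Z); parked, not closed — `ledger route dormant route-PneNP-RootDecompExpl (operator:999:964070)

sub-problem: PneNP · status: dormant · opened planner-decomp-pnenp-writer-1-g5-0 2026-08-30T08:44:53Z · rev 0 · ledger route-PneNP-RootDecompExplicitRandom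
GENERATED by the gate from the ledger (D-0016/17). Provers cite these decls: `theorem foo : Summit.PneNP.PneNP.Theses.RootDecompExplicitRandom.<Decl> := …` in Summits/PneNP/PneNP/Theorems/<Name>.lean.
-/

namespace Summit.PneNP.PneNP.Theses.RootDecompExplicitRandom

open scoped BigOperators Topology Manifold Classical MeasureTheory ProbabilityTheory Matrix InnerProductSpace ComplexConjugate ContinuousMap
open Filter Set Function TopologicalSpace MeasureTheory

attribute [summit_statement] _root_.PneNP

open Literature.PNP

/-- item stmt-PneNP-31302 · crux · rank 2 · open · by planner
why it might fail: ¬S yields the printer only at an exponent b(c_SAT) of the PH-collapse prefix search, not b = 4: a SLOW Algorithmica (P = NP with large collapse exponent and no fast K-oracle) falsifies it; no relativized evidence either way is typed.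
sources: doi:10.4230/LIPIcs.CCC.2025.35 (Korten–Santhanam CCC 2025, Question 1 p.2; Thms 2–3, 23–25), galaxy:pdf:2728609284854220960 (Ren–Santhanam–Wang FOCS 2022, range avoidance, Hyp. II.13 p.12–13), LiVitanyi2019 Thm 2.2.1 (counting), HOME/decomp-pnenp-lens-3/ExplicitRandomDial.lean sha256 36e603a8, HOME/critic/L3_ExplicitRandomDial_g7_probe.lean sha256 48547370
[crux r2 · piece A «shadow» · ATTACKED · tags WEAKER / NECESSARY / not-COSTUME / UNDECIDED · leaf
IDEA-NEEDED, LOCATED] CUT PREDICATE Y := ExplicitStd id 3 4 = «ONE fixed program e of the standard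
clocked interpreter, fed the binary numeral of n and run n^4 rounds, outputs an n-bit string x with
K_std^{n^3}(x) ≥ n (x ∈ R_{K^{n^3}}), for all large n» — Korten–Santhanam Question 1 at T = n^3,
maximal threshold ℓ = n, construction exponent 4. Piece A: in Algorithmica (¬S, i.e. P = NP) the
explicit printer exists AT FIXED EXPONENT 4. Evidence WEAKER: ¬S gives `ExplicitStd id 3 b` only for
a b depending on the unknown collapse exponent (lens kernel `exists_b_of_not_pneNP` /
`ksq1_of_not_pneNP`: the Δ₃ᵖ prefix search for the canonical incompressible string, via tree
`szkEntropy_phCollapse_standalone`, mod the two print binders CanonBitsInPHStd,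
PrinterFromDeciderStd), never b = 4; failure world = a SLOW Algorithmica, refuted by nothing in
print. Not COSTUME: the costume cells of the column are exactly b ≤ 3 (kernel
`hard_iff_pneNP_of_le`, `hard33_iff_pneNP`; aside BottomRefuted33 proved), (3,4) is the first cell
outside, and the machine is DEFINITE (no junk member decides: erratum g6). N -/
@[route_item "route-PneNP-RootDecompExplicitRandom"]
def ExplicitHard : Prop :=
  ¬ PneNP → ∃ (e : List Bool) (n₀ : ℕ), ∀ n : ℕ, n₀ ≤ n → ∃ x : List Bool, Literature.Computability.Complexity.ClockedUS.run (Literature.Computability.Complexity.boolPair e ((Nat.digits 2 n).map fun d => decide (d = 1))) (n ^ 4) = some x ∧ x.length = n ∧ ((id n : ℕ) : ℕ∞) ≤ ⨅ (prog : List Bool) (_ : Literature.Computability.Complexity.ClockedUS.run prog (n ^ 3) = some x), (prog.length : ℕ∞)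

/-- item stmt-PneNP-31303 · crux · rank 3 · open · by planner
why it might fail: False in a FAST Algorithmica: P = NP decided in low polynomial degree is consistent with an n^4-round printer of K^{n^3}-random strings (the prefix search then runs inside n^4); no theorem links KS25 Question 1 to P vs NP.
sources: doi:10.4230/LIPIcs.CCC.2025.35 (Korten–Santhanam CCC 2025, Question 1 p.2; Thms 2–3, 23–25), galaxy:pdf:2728609284854220960 (Ren–Santhanam–Wang FOCS 2022, range avoidance, Hyp. II.13 p.12–13), HOME/decomp-pnenp-lens-3/ExplicitRandomDial.lean sha256 36e603a8, HOME/decomp-pnenp-lens-3/erd/NODE-g7.md sha256 909a658c, HOME/critic/L3_ExplicitRandomDial_g7_probe.lean sha256 48547370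
[crux r3 · piece B «lift» · DECLARED RESIDUAL (tribunal_fit.residual) · tags WEAKER / NECESSARY /
not-COSTUME / UNDECIDED] CUT PREDICATE Y := ExplicitStd id 3 4 = «ONE fixed program e of the
standard clocked interpreter, fed the binary numeral of n and run n^4 rounds, outputs an n-bit
string x with K_std^{n^3}(x) ≥ n (x ∈ R_{K^{n^3}}), for all large n» — Korten–Santhanam Question 1
at T = n^3, maximal threshold ℓ = n, construction exponent 4. Piece B: a fixed-exponent explicit
printer of R_{K^{n^3}} already separates P from NP. False exactly in a FAST Algorithmica (P = NP in
low degree together with such a printer); refuted by no theorem; RSW22 p.13 leaves «any formal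
connection between Hypothesis II.13 and other hardness assumptions» open; KS25 p.2: «we currently do
not have clear positive or negative complexity-theoretic evidence» for Question 1. Not COSTUME: the
costume version of the lift is the CLOSURE (Question-1) lift, ≡ S by theorem mod print binders (lens
`ksq1Lift_iff_pneNP`; aside KSQ1LiftId), and the g6 ∀U-lift was a theorem by junk — this one is over
the definite machine. RESIDUAL MOVE OF RECORD (kernel, pack `lift_of_liftSqrt`): the g6-style
residual at threshold √n ( -/
@[route_item "route-PneNP-RootDecompExplicitRandom"]
def ExplicitLift : Prop :=
  (∃ (e : List Bool) (n₀ : ℕ), ∀ n : ℕ, n₀ ≤ n → ∃ x : List Bool, Literature.Computability.Complexity.ClockedUS.run (Literature.Computability.Complexity.boolPair e ((Nat.digits 2 n).map fun d => decide (d = 1))) (n ^ 4) = some x ∧ x.length = n ∧ ((id n : ℕ) : ℕ∞) ≤ ⨅ (prog : List Bool) (_ : Literature.Computability.Complexity.ClockedUS.run prog (n ^ 3) = some x), (prog.length : ℕ∞)) → PneNP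

/-- item stmt-PneNP-31304 · aside · rank 9 · open · by planner
why it might fail: Same slow-Algorithmica failure world as ExplicitHard (weaker threshold, same exponent 4).
sources: HOME/decomp-pnenp-lens-3/ExplicitRandomDial.lean sha256 36e603a8, writer folder/n28_explicit/N28_items.lean sha256 c7a9d286
[aside · banked, never staffed · the generation-6 cell (threshold √n) re-typed on the standard
machine: shadow] ¬S → ExplicitStd Nat.sqrt 3 4. Implied by ExplicitHard (pack `hardSqrt_of_hard`,
kernel; r-antitonicity); same evidence class (closure-true, cell-undecided). Kept so the g6 → g7
residual move is visible by decl. PROVENANCE: root-decomposition cell decomp-pnenp (D-0178),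
proposal P28 = lens-3 gen 7 NODE «ExplicitRandomDial v2»
(HOME/decomp-pnenp-lens-3/ExplicitRandomDial.lean sha256 36e603a8;
HOME/decomp-pnenp-lens-3/erd/NODE-g7.md sha256 909a658c); critic decomp-pnenp-crit-1 g4 NODE-VERDICT
2026-08-30T07:50:21Z CLEARED (0 blocking objections; HOME/critic/L3_ExplicitRandomDial_g7_probe.lean
sha256 48547370, farm rc0 / 0 sorry / 73 AXOK); census COSTUME-CENSUS v10 (702f26e9) row NER +
typing audit T56 (answered: the g6 ∀U-typing was throttlable — erratum recorded, v2 re-typed on ONE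
definite machine); writer pack writer folder/n28_explicit/N28_items.lean sha256 c7a9d286 (lean check
rc0, 0 sorry; the lens machine stdM := ⟨ClockedUS.run, run_mono, polyTime_run, sim, print_of_sim⟩ is
INLINED here as the tree interpreter `ClockedUS.run` and `stdM.ktAt` as the infimum that defin -/
@[route_item "route-PneNP-RootDecompExplicitRandom"]
def ExplicitHardSqrt : Prop :=
  ¬ PneNP → ∃ (e : List Bool) (n₀ : ℕ), ∀ n : ℕ, n₀ ≤ n → ∃ x : List Bool, Literature.Computability.Complexity.ClockedUS.run (Literature.Computability.Complexity.boolPair e ((Nat.digits 2 n).map fun d => decide (d = 1))) (n ^ 4) = some x ∧ x.length = n ∧ ((Nat.sqrt n : ℕ) : ℕ∞) ≤ ⨅ (prog : List Bool) (_ : Literature.Computability.Complexity.ClockedUS.run prog (n ^ 3) = some x), (prog.length : ℕ∞)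

/-- item stmt-PneNP-31305 · aside · rank 9 · open · by planner
why it might fail: Stronger than ExplicitLift (weaker hypothesis): false in any fast Algorithmica printing merely √n-incompressible strings in n^4 rounds.
sources: HOME/decomp-pnenp-lens-3/ExplicitRandomDial.lean sha256 36e603a8, writer folder/n28_explicit/N28_items.lean sha256 c7a9d286
[aside · banked · the OLD (g6-style) residual at threshold √n over the standard machine] ExplicitStd
Nat.sqrt 3 4 → S. IMPLIES the declared residual ExplicitLift (pack `lift_of_liftSqrt`, kernel) — the
residual move of record √ ↦ id. PROVENANCE: root-decomposition cell decomp-pnenp (D-0178), proposal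
P28 = lens-3 gen 7 NODE «ExplicitRandomDial v2» (HOME/decomp-pnenp-lens-3/ExplicitRandomDial.lean
sha256 36e603a8; HOME/decomp-pnenp-lens-3/erd/NODE-g7.md sha256 909a658c); critic
decomp-pnenp-crit-1 g4 NODE-VERDICT 2026-08-30T07:50:21Z CLEARED (0 blocking objections;
HOME/critic/L3_ExplicitRandomDial_g7_probe.lean sha256 48547370, farm rc0 / 0 sorry / 73 AXOK);
census COSTUME-CENSUS v10 (702f26e9) row NER + typing audit T56 (answered: the g6 ∀U-typing was
throttlable — erratum recorded, v2 re-typed on ONE definite machine); writer pack writer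
folder/n28_explicit/N28_items.lean sha256 c7a9d286 (lean check rc0, 0 sorry; the lens machine stdM
:= ⟨ClockedUS.run, run_mono, polyTime_run, sim, print_of_sim⟩ is INLINED here as the tree
interpreter `ClockedUS.run` and `stdM.ktAt` as the infimum that defines `UniversalMachine.ktAt` over
it — kernel anchors `anchor_lens_*` in the pack prove the -/
@[route_item "route-PneNP-RootDecompExplicitRandom"]
def ExplicitLiftSqrt : Prop :=
  (∃ (e : List Bool) (n₀ : ℕ), ∀ n : ℕ, n₀ ≤ n → ∃ x : List Bool, Literature.Computability.Complexity.ClockedUS.run (Literature.Computability.Complexity.boolPair e ((Nat.digits 2 n).map fun d => decide (d = 1))) (n ^ 4) = some x ∧ x.length = n ∧ ((Nat.sqrt n : ℕ) : ℕ∞) ≤ ⨅ (prog : List Bool) (_ : Literature.Computability.Complexity.ClockedUS.run prog (n ^ 3) = some x), (prog.length : ℕ∞)) → PneNP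

/-- item stmt-PneNP-31306 · aside · rank 9 · open · by planner
why it might fail: Only the two print binders (canonical-string language in PH; printer-from-decider plumbing on ClockedUS) stand between this and a theorem; typing them is L-sized.
sources: doi:10.4230/LIPIcs.CCC.2025.35 (Korten–Santhanam CCC 2025, Question 1 p.2; Thms 2–3, 23–25), HOME/decomp-pnenp-lens-3/ExplicitRandomDial.lean sha256 36e603a8, tree Summits/PneNP/PneNP/Theorems/SzkEntropyPhCollapseStandalone.lean
[aside · banked · CLOSURE END of the dial = Korten–Santhanam Question 1 in Algorithmica, threshold
id] ¬S → ∀ a ∃ b, ExplicitStd id a b. TRUE modulo the two PRINT binders CanonBitsInPHStd (the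
canonical incompressible string's bit language ∈ Δ₃ᵖ ⊆ PH; folklore quantifier count) and
PrinterFromDeciderStd (machine plumbing) — lens kernel `ksq1Hard_of_binders` via tree
`szkEntropy_phCollapse_standalone`; the binders are pencil-true, used on this aside's edge only,
never in closes. Records WHY only fixed cells host a split. PROVENANCE: root-decomposition cell
decomp-pnenp (D-0178), proposal P28 = lens-3 gen 7 NODE «ExplicitRandomDial v2»
(HOME/decomp-pnenp-lens-3/ExplicitRandomDial.lean sha256 36e603a8;
HOME/decomp-pnenp-lens-3/erd/NODE-g7.md sha256 909a658c); critic decomp-pnenp-crit-1 g4 NODE-VERDICT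
2026-08-30T07:50:21Z CLEARED (0 blocking objections; HOME/critic/L3_ExplicitRandomDial_g7_probe.lean
sha256 48547370, farm rc0 / 0 sorry / 73 AXOK); census COSTUME-CENSUS v10 (702f26e9) row NER +
typing audit T56 (answered: the g6 ∀U-typing was throttlable — erratum recorded, v2 re-typed on ONE
definite machine); writer pack writer folder/n28_explicit/N28_items.lean sha256 c7a9d286 (lean -/
@[route_item "route-PneNP-RootDecompExplicitRandom"]
def KSQ1HardId : Prop :=
  ¬ PneNP → ∀ a : ℕ, ∃ b : ℕ, ∃ (e : List Bool) (n₀ : ℕ), ∀ n : ℕ, n₀ ≤ n → ∃ x : List Bool, Literature.Computability.Complexity.ClockedUS.run (Literature.Computability.Complexity.boolPair e ((Nat.digits 2 n).map fun d => decide (d = 1))) (n ^ b) = some x ∧ x.length = n ∧ ((id n : ℕ) : ℕ∞) ≤ ⨅ (prog : List Bool) (_ : Literature.Computability.Complexity.ClockedUS.run prog (n ^ a) = some x), (prog.length : ℕ∞)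

/-- item stmt-PneNP-31307 · aside · rank 9 · open · by planner
why it might fail: Equivalent to the summit modulo two pencil-true print binders (lens ksq1Lift_iff_pneNP): exactly as hard as P ≠ NP.
sources: doi:10.4230/LIPIcs.CCC.2025.35 (Korten–Santhanam CCC 2025, Question 1 p.2; Thms 2–3, 23–25), HOME/decomp-pnenp-lens-3/ExplicitRandomDial.lean sha256 36e603a8
[aside · banked · COSTUME BY THEOREM, recorded] (∀ a ∃ b, ExplicitStd id a b) → S: ≡ S modulo the
print binders (lens kernel `ksq1Lift_iff_pneNP`) — the Question-1 lift carries the whole summit, so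
Question 1 itself hosts no split; listed so no seat re-files it as a crux. PROVENANCE:
root-decomposition cell decomp-pnenp (D-0178), proposal P28 = lens-3 gen 7 NODE «ExplicitRandomDial
v2» (HOME/decomp-pnenp-lens-3/ExplicitRandomDial.lean sha256 36e603a8;
HOME/decomp-pnenp-lens-3/erd/NODE-g7.md sha256 909a658c); critic decomp-pnenp-crit-1 g4 NODE-VERDICT
2026-08-30T07:50:21Z CLEARED (0 blocking objections; HOME/critic/L3_ExplicitRandomDial_g7_probe.lean
sha256 48547370, farm rc0 / 0 sorry / 73 AXOK); census COSTUME-CENSUS v10 (702f26e9) row NER +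
typing audit T56 (answered: the g6 ∀U-typing was throttlable — erratum recorded, v2 re-typed on ONE
definite machine); writer pack writer folder/n28_explicit/N28_items.lean sha256 c7a9d286 (lean check
rc0, 0 sorry; the lens machine stdM := ⟨ClockedUS.run, run_mono, polyTime_run, sim, print_of_sim⟩ is
INLINED here as the tree interpreter `ClockedUS.run` and `stdM.ktAt` as the infimum that defines
`UniversalMachine.ktAt` over it — kernel anchors -/
@[route_item "route-PneNP-RootDecompExplicitRandom"]
def KSQ1LiftId : Prop :=
  (∀ a : ℕ, ∃ b : ℕ, ∃ (e : List Bool) (n₀ : ℕ), ∀ n : ℕ, n₀ ≤ n → ∃ x : List Bool, Literature.Computability.Complexity.ClockedUS.run (Literature.Computability.Complexity.boolPair e ((Nat.digits 2 n).map fun d => decide (d = 1))) (n ^ b) = some x ∧ x.length = n ∧ ((id n : ℕ) : ℕ∞) ≤ ⨅ (prog : List Bool) (_ : Literature.Computability.Complexity.ClockedUS.run prog (n ^ a) = some x), (prog.length : ℕ∞)) → PneNP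

/-- item stmt-PneNP-31308 · aside · rank 9 · closed · proved by Summit.PneNP.PneNP.Theorems.bottomRefuted33_proof (prover) · by planner
why it might fail: Decided: proved in the writer pack (bottomRefuted33_holds, axioms propext/choice/Quot.sound); can only fail by a porting slip of the inlined ktAt infimum.
sources: HOME/decomp-pnenp-lens-3/ExplicitRandomDial.lean sha256 36e603a8, writer folder/n28_explicit/N28_items.lean sha256 c7a9d286, LiVitanyi2019 Thm 2.2.1
[aside · DECIDED TRUE in kernel (pack `bottomRefuted33_holds`, verbatim port of the lens chain
ktAt_le_of_run / not_explicitOn_of_le / log_add_lt_id / not_explicitStd_id_of_le) · the located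
costume cell just below the node] ¬ ExplicitStd id 3 3: at every notch b ≤ a the constructing
program ⟨e, bin n⟩ is itself a description of length log₂ n + 2|e| + 3 < n printing x within n^b ≤
n^a rounds, so no cell b ≤ a holds on any machine; hence there the shadow IS the summit (pack
`hard33_iff_pneNP : (¬S → ¬BottomRefuted33) ↔ S`) and the lift is a theorem ex falso. BC5-style
first rung of the cut-predicate family decided in a regime where S is not (S-agnostic counting +
simulation law). Provable-now: port the pack proof (≈ 90 lines, imports UniversalMachineProofs
only). PROVENANCE: root-decomposition cell decomp-pnenp (D-0178), proposal P28 = lens-3 gen 7 NODE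
«ExplicitRandomDial v2» (HOME/decomp-pnenp-lens-3/ExplicitRandomDial.lean sha256 36e603a8;
HOME/decomp-pnenp-lens-3/erd/NODE-g7.md sha256 909a658c); critic decomp-pnenp-crit-1 g4 NODE-VERDICT
2026-08-30T07:50:21Z CLEARED (0 blocking objections; HOME/critic/L3_ExplicitRandomDial_g7_probe.lean
sha256 48547370, farm rc0 / 0 sorry / 73 A -/
@[route_item "route-PneNP-RootDecompExplicitRandom"]
def BottomRefuted33 : Prop :=
  ¬ (∃ (e : List Bool) (n₀ : ℕ), ∀ n : ℕ, n₀ ≤ n → ∃ x : List Bool, Literature.Computability.Complexity.ClockedUS.run (Literature.Computability.Complexity.boolPair e ((Nat.digits 2 n).map fun d => decide (d = 1))) (n ^ 3) = some x ∧ x.length = n ∧ ((id n : ℕ) : ℕ∞) ≤ ⨅ (prog : List Bool) (_ : Literature.Computability.Complexity.ClockedUS.run prog (n ^ 3) = some x), (prog.length : ℕ∞))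

-- `BottomRefuted33` holds: proved by `Summit.PneNP.PneNP.Theorems.bottomRefuted33_proof` (its module imports this route file, so no `_holds` link can be stated here).

/-- item stmt-PneNP-31309 · assembly · rank 1 · open · by planner
why it might fail: Cannot fail: closes is three lines of propositional logic, certified native by route check.
sources: HOME/decomp-pnenp-lens-3/ExplicitRandomDial.lean sha256 36e603a8, writer folder/n28_explicit/N28_items.lean sha256 c7a9d286
[assembly] the two pieces give the summit by pure logic (by_contra; both binders used) — glue.lean
`closes`; exactness `pneNP_iff : PneNP ↔ ExplicitHard ∧ ExplicitLift` hyp-free in the pack.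
PROVENANCE: root-decomposition cell decomp-pnenp (D-0178), proposal P28 = lens-3 gen 7 NODE
«ExplicitRandomDial v2» (HOME/decomp-pnenp-lens-3/ExplicitRandomDial.lean sha256 36e603a8;
HOME/decomp-pnenp-lens-3/erd/NODE-g7.md sha256 909a658c); critic decomp-pnenp-crit-1 g4 NODE-VERDICT
2026-08-30T07:50:21Z CLEARED (0 blocking objections; HOME/critic/L3_ExplicitRandomDial_g7_probe.lean
sha256 48547370, farm rc0 / 0 sorry / 73 AXOK); census COSTUME-CENSUS v10 (702f26e9) row NER +
typing audit T56 (answered: the g6 ∀U-typing was throttlable — erratum recorded, v2 re-typed on ONE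
definite machine); writer pack writer folder/n28_explicit/N28_items.lean sha256 c7a9d286 (lean check
rc0, 0 sorry; the lens machine stdM := ⟨ClockedUS.run, run_mono, polyTime_run, sim, print_of_sim⟩ is
INLINED here as the tree interpreter `ClockedUS.run` and `stdM.ktAt` as the infimum that defines
`UniversalMachine.ktAt` over it — kernel anchors `anchor_lens_*` in the pack prove the inlined
bodies ↔ the lens bodies). -/
@[route_item "route-PneNP-RootDecompExplicitRandom"]
def Assembly : Prop :=
  ExplicitHard → ExplicitLift → PneNP

/-! D-0027 §2.1 — DECIDING THEOREM (planner-authored via `route open/edit --closes-file`; by planner-decomp-pnenp-writer-1-g5-0 2026-08-30T08:44:53Z):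
its hypotheses are this route's items and its conclusion the sub-problem Statement (glue_lint), and it elaborates with this file. -/

@[closes "route-PneNP-RootDecompExplicitRandom"] theorem closes (hA : ExplicitHard) (hB : ExplicitLift) : _root_.PneNP := by
  by_contra hS
  exact hS (hB (hA hS))

end Summit.PneNP.PneNP.Theses.RootDecompExplicitRandom
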